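import Summits.Ventures.YMGap.YM3IR.DecayTransferInMean
import Summits.Ventures.YMGap.YM3IR.DecayTransferFree
import Summits.Ventures.YMGap.YM3IR.BallInstance
import Summits.Ventures.YMGap.YM3IR.CarrierFamily
import HarnessLib

/-!
# YM₃ infrared statement — the IN-MEAN (L¹) form of the fluctuation hypothesis and the composition with it
# (cell `pub-ymgap`, track Y4; ym3ir-theory-2, «weakest printed-form hypotheses»)

HONEST FRAMING.  This file NAMES a weaker form of the one conjectural hypothesis of the YM₃ infrared statement and
PROVES that the composition `… ⟹ MassGap3Cofinal` of `YM3IR/Statement.lean` goes through with it.  It proves NOTHING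
about Yang–Mills: `FluctuationDecouplingInMeanAt` / `IRConjecture3InMean` / `T_IRInMean` below are CONJECTURES (NOT in
print), exactly as their almost-sure parents `FluctuationDecouplingAt` / `IRConjecture3` / `T_IR`; the target
`MassGap3Cofinal` is untouched.  ONE TARGET OF RECORD remains `MassGap3Cofinal I r ρ` of `YM3IR/Statement.lean`
(statement ownership unchanged): the in-mean predicates are weaker-HYPOTHESIS BRIDGES into that one target, not a second
target and not an alternative statement (lead, 2026-08-22T23:01Z).  No axiom, no `sorry`, 0 compute.

WHAT IS WEAKENED AND WHY IT MATTERS.  The statement of record asks, ALMOST SURELY in the coarse field `V = blk U`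
(w.r.t. the fine Wilson law), (i) `|condCov(f, g | V)| ≤ c ΣδfΣδg e^{−κn/b}` and (ii) `|E[f | V] − h_f∘blk| ≤ c Σδf e^{−κR}`.
«Almost every coarse field» includes the ROUGH / LARGE coarse fields, where no small-background expansion exists
(Bałaban's fluctuation-propagator decay, CMP 99 (1985) Thm 3.1, is stated under the regularity condition (3.35) on the
background; large fields are handled in print by small PROBABILITY, not by uniform bounds — CMP 102 (1985) Thm 2,
(41)/(47)).  A uniform a.s. bound is therefore MORE than the printed mechanism suggests and plausibly false as typed,
while the composition never used it: ds-1's proof of `DecayTransfer` consumes only `|E[condCov]|` and an `L¹` bound on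
`E[f|V] − h_f∘blk` (certified in `DecayTransferInMean.clustersWith_fine_of_inMean`).  The in-mean clauses
(i′) `∫ |condCov(f, g | V)| dμ ≤ c ΣδfΣδg e^{−κn/b}`, (ii′) `∫ |E[f | V] − h_f∘blk| dμ ≤ c Σδf e^{−κR}` are implied by the
a.s. ones (`fluctuationDecouplingInMeanAt_of_at`) and are the form a large-field/small-field split of the MEASURE delivers
(small-field region: the perturbative bound; large-field region: bounded integrand × small probability).
STAND-ALONE CONTENT WARNING (unchanged from the parents; negatives-index lesson `not_RobustYangMillsRG`,
stmt-QuantumFields-14958): clause (a) `EntersClusterDomain` alone is cheap for a wild transport, the fluctuation clause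
alone is cheap for the identity block map; quote only the conjunction over ONE `W` (`IRConjecture3InMean`).

CONTENTS.  §1 the predicates; §2 a.s. ⟹ in-mean; §3 the decay transfer and the composition
`BalabanUV3 ∧ ClusterDomainClustering ∧ T_IRInMean ⟹ MassGap3Cofinal I` (`massGap3Cofinal_of_inMean`, no side condition
on `ρ` thanks to ds-1's `DecayTransferProof.isProbabilityMeasure_or_eq_zero_wilsonMeasure`; the statement of record
`massGap3Cofinal_of` is recovered through it, `massGap3Cofinal_of_t_IR_via_inMean`);
§4 instances: Y2's `SU(N)` ball (`massGap3Cofinal_SUN_of_irConjecture3InMean`, and the a.s. one-liner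
`massGap3Cofinal_SUN_of_irConjecture3`) and Bałaban's coupling set (`massGap3Cofinal_balaban_of_irConjecture3InMean`).
WHY THIS IS NOVEL (bookkeeping sense only): the YM₃ infrared promise «print ∧ Y2 ∧ ONE conjecture ⟹ cofinal lattice
mass gap» is kernel-checked with the conjecture in its weakest form used, an `L¹` statement about the block-spin
conditional laws.

References: T. Bałaban, CMP 99 (1985) 389, Thm 3.1 [cite: Balaban1985BackgroundPropagators]; T. Bałaban, CMP 102
(1985) 255, Thm 2 [cite: Balaban1985UV3]; H. Föllmer, LNM 1362 (1988) Ch. I [cite: Follmer1988]; K. Osterwalder,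
E. Seiler, Ann. Phys. 110 (1978) 440 [cite: OsterwalderSeilerAnnPhys1978].
-/

noncomputable section

open MeasureTheory ProbabilityTheory Filter Finset
open Literature.Probability.LatticeModels Literature.Probability.LatticeModels.DobrushinMetric
open Literature.MathematicalPhysics.QuantumFieldTheory

namespace Summit.Ventures.YMGap.YM3IR

section Predicates

variable {G : Type} [MeasurableSpace G] {N : ℕ} [Group G] [TopologicalSpace G] [IsTopologicalGroup G]
  [CompactSpace G] [BorelSpace G]

/-! ## §1 The in-mean predicates (CONJECTURES, NOT in print) -/

/-- **`FluctuationDecouplingInMeanAt r ρ W β κ` (CONJECTURE, the `L¹` form of T_IR(b); NOT in print — perturbative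
germ IN PRINT: Bałaban CMP 99 (1985) Thm 3.1).**  At bare coupling `β`, with ONE constant `c` for all volumes, IN MEAN
over the fine Wilson law: (i′) `∫ |condCov(f, g | V)| ≤ c (Σδf)(Σδg) e^{−κ n / b(β)}` for bounded cylinder observables
at fine torus distance `≥ n`; (ii′) `E[f | V]` is within `c (Σδf) e^{−κ R}` in `L¹` of a bounded measurable cylinder
function `h ∘ blk` of the coarse field supported in `coarseHull b M Δf R`, coarse loads `Σ δh ≤ c Σ δf`.  Implied by
`FluctuationDecouplingAt` (`fluctuationDecouplingInMeanAt_of_at`); sufficient for the decay transfer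
(`fineUniformClustering_of_inMean`).  Why it might still fail: the regime `n ≲ b`, and large fields of not-small
probability at intermediate scales.  NOT a stand-alone conjecture (identity block map). [cite: Balaban1985BackgroundPropagators, Thm 3.1] -/
@[conjecture] def FluctuationDecouplingInMeanAt (r : G → G → ℝ) (ρ : G →* Matrix (Fin N) (Fin N) ℂ)
    (W : BlockFamily G) (β κ : ℝ) : Prop :=
  ∃ c : ℝ, ∀ (M : ℕ) [NeZero M],
    -- (i′) conditional covariance decay at scale `b(β)`, in mean
    (∀ (f g : GaugeConfig 3 (W.factor β * M) G → ℝ) (Δf Δg : Finset (Edge 3 (W.factor β * M)))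
        (δf δg : Edge 3 (W.factor β * M) → ℝ) (n : ℕ),
      Measurable f → Measurable g → DependsOn f (↑Δf : Set _) → DependsOn g (↑Δg : Set _) →
      (∃ C, ∀ U, |f U| ≤ C) → (∃ C, ∀ U, |g U| ≤ C) → IsLipBound r f δf → IsLipBound r g δg →
      (∀ x ∈ Δf, ∀ y ∈ Δg, n ≤ torusNorm (x.1 - y.1)) →
        ∫ U, |condCov W β M (fineLaw ρ β W M) f g U| ∂(fineLaw ρ β W M)
          ≤ c * (∑ x ∈ Δf, δf x) * (∑ y ∈ Δg, δg y) * Real.exp (-κ * n / W.factor β)) ∧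
    -- (ii′) quasi-locality of conditional expectations in the coarse field, in mean
    (∀ (f : GaugeConfig 3 (W.factor β * M) G → ℝ) (Δf : Finset (Edge 3 (W.factor β * M)))
        (δf : Edge 3 (W.factor β * M) → ℝ) (R : ℕ),
      Measurable f → DependsOn f (↑Δf : Set _) → (∃ C, ∀ U, |f U| ≤ C) → IsLipBound r f δf →
      ∃ (h : GaugeConfig 3 M G → ℝ) (Δh : Finset (Edge 3 M)) (δh : Edge 3 M → ℝ),
        Measurable h ∧ DependsOn h (↑Δh : Set _) ∧ (↑Δh : Set _) ⊆ coarseHull (W.factor β) M Δf R ∧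
        (∃ C, ∀ V, |h V| ≤ C) ∧ IsLipBound r h δh ∧ (∑ y ∈ Δh, δh y) ≤ c * ∑ x ∈ Δf, δf x ∧
        ∫ U, |condExp (coarseSigma W β M) (fineLaw ρ β W M) f U - h (W.blk β M U)| ∂(fineLaw ρ β W M)
          ≤ c * (∑ x ∈ Δf, δf x) * Real.exp (-κ * R))

/-- **`FluctuationDecouplingInMean r ρ W I κ` (CONJECTURE):** the in-mean clauses at every `β ∈ I`, same block-scale
fluctuation mass `κ` (constant may depend on `β`). [cite: Balaban1985BackgroundPropagators, Thm 3.1] -/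
@[conjecture] def FluctuationDecouplingInMean (r : G → G → ℝ) (ρ : G →* Matrix (Fin N) (Fin N) ℂ)
    (W : BlockFamily G) (I : Set ℝ) (κ : ℝ) : Prop :=
  ∀ β ∈ I, FluctuationDecouplingInMeanAt r ρ W β κ

/-- **`T_IRInMean` — `T_IR` with the fluctuation conjunct in mean and WITHOUT the support conjunct `DecayTransfer`**
(which is a theorem in either currency: `DecayTransferProof.decayTransfer`, `fineUniformClustering_of_inMean`):
one block family with `Crossover3` (T_IR(a) from Bałaban's UV stability) and `FluctuationDecouplingInMean`.
CONJECTURE. -/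
@[conjecture] def T_IRInMean {L : ℕ} (mk : Balaban1985CMP102.Theorems.Construction L) (B : BallSpec G N)
    (r : G → G → ℝ) (ρ : G →* Matrix (Fin N) (Fin N) ℂ) (I : Set ℝ) (C_b κ : ℝ) : Prop :=
  ∃ W : BlockFamily G, Crossover3 mk B ρ W I C_b ∧ FluctuationDecouplingInMean r ρ W I κ

/-- **`IRConjecture3InMean B r ρ I C_b κ` — the quotable conjecture in its weakest used form (CONJECTURE; NOT in
print):** ONE block family whose coarse laws enter Y2's ball with a linear block factor AND whose fluctuation field
decouples IN MEAN.  Implied by `IRConjecture3` (`irConjecture3InMean_of_irConjecture3`); implies the cofinal mass gap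
given print and Y2 (`massGap3Cofinal_of_irConjecture3InMean`).  Quote only this conjunction, never a conjunct. -/
@[conjecture] def IRConjecture3InMean (B : BallSpec G N) (r : G → G → ℝ)
    (ρ : G →* Matrix (Fin N) (Fin N) ℂ) (I : Set ℝ) (C_b κ : ℝ) : Prop :=
  ∃ W : BlockFamily G, EntersClusterDomain B ρ W I C_b ∧ FluctuationDecouplingInMean r ρ W I κ

/-! ## §2 Almost-sure ⟹ in-mean (PROVED) -/

/-- The a.s. clauses imply the in-mean clauses at one coupling (constant `max c 0`), on probability-or-zero fine
laws. [folklore] -/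
theorem fluctuationDecouplingInMeanAt_of_at {ρ : G →* Matrix (Fin N) (Fin N) ℂ} {r : G → G → ℝ}
    {W : BlockFamily G} {β κ : ℝ}
    (hP : ∀ (M : ℕ) [NeZero M], IsProbabilityMeasure (fineLaw ρ β W M) ∨ fineLaw ρ β W M = 0)
    (h : FluctuationDecouplingAt r ρ W β κ) : FluctuationDecouplingInMeanAt r ρ W β κ := by
  obtain ⟨c, hc⟩ := h
  have hc0 : c ≤ max c 0 := le_max_left _ _
  have hm0 : 0 ≤ max c 0 := le_max_right _ _
  refine ⟨max c 0, fun M _ => ?_⟩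
  obtain ⟨h1, h2⟩ := hc M
  constructor
  · intro f g Δf Δg δf δg n hf hg hdf hdg hbf hbg hlf hlg hn
    have hSf : 0 ≤ ∑ x ∈ Δf, δf x := sum_nonneg fun x _ => hlf.nonneg x
    have hSg : 0 ≤ ∑ y ∈ Δg, δg y := sum_nonneg fun y _ => hlg.nonneg y
    have hK : c * (∑ x ∈ Δf, δf x) * (∑ y ∈ Δg, δg y) * Real.exp (-κ * n / W.factor β)
        ≤ max c 0 * (∑ x ∈ Δf, δf x) * (∑ y ∈ Δg, δg y) * Real.exp (-κ * n / W.factor β) :=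
      mul_le_mul_of_nonneg_right (mul_le_mul_of_nonneg_right (mul_le_mul_of_nonneg_right hc0 hSf) hSg)
        (Real.exp_pos _).le
    exact DecayTransferInMean.integral_abs_le_of_ae_abs_le (hP M)
      (mul_nonneg (mul_nonneg (mul_nonneg hm0 hSf) hSg) (Real.exp_pos _).le)
      ((h1 f g Δf Δg δf δg n hf hg hdf hdg hbf hbg hlf hlg hn).mono fun U hU => hU.trans hK)
  · intro f Δf δf R hf hdf hbf hlf
    obtain ⟨h, Δh, δh, hhm, hhd, hsub, hhb, hhl, hsum, hae⟩ := h2 f Δf δf R hf hdf hbf hlf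
    have hSf : 0 ≤ ∑ x ∈ Δf, δf x := sum_nonneg fun x _ => hlf.nonneg x
    refine ⟨h, Δh, δh, hhm, hhd, hsub, hhb, hhl, hsum.trans (mul_le_mul_of_nonneg_right hc0 hSf), ?_⟩
    have hK : c * (∑ x ∈ Δf, δf x) * Real.exp (-κ * R) ≤ max c 0 * (∑ x ∈ Δf, δf x) * Real.exp (-κ * R) :=
      mul_le_mul_of_nonneg_right (mul_le_mul_of_nonneg_right hc0 hSf) (Real.exp_pos _).le
    exact DecayTransferInMean.integral_abs_le_of_ae_abs_le (hP M)
      (mul_nonneg (mul_nonneg hm0 hSf) (Real.exp_pos _).le) (hae.mono fun U hU => hU.trans hK)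

/-- `FluctuationDecoupling ⟹ FluctuationDecouplingInMean` (every `ρ`: a torus Wilson law is a probability measure or
zero, ds-1's `DecayTransferProof.isProbabilityMeasure_or_eq_zero_wilsonMeasure`). [folklore] -/
theorem fluctuationDecouplingInMean_of {ρ : G →* Matrix (Fin N) (Fin N) ℂ} {r : G → G → ℝ}
    {W : BlockFamily G} {I : Set ℝ} {κ : ℝ} (h : FluctuationDecoupling r ρ W I κ) :
    FluctuationDecouplingInMean r ρ W I κ := fun β hβ =>
  fluctuationDecouplingInMeanAt_of_at
    (fun M _ => DecayTransferProof.isProbabilityMeasure_or_eq_zero_wilsonMeasure (d := 3) (L := W.factor β * M) ρ β)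
    (h β hβ)

/-- `T_IR ⟹ T_IRInMean` (the support conjunct is dropped). [folklore] -/
theorem t_IRInMean_of_t_IR {L : ℕ} {mk : Balaban1985CMP102.Theorems.Construction L} {B : BallSpec G N}
    {r : G → G → ℝ} {ρ : G →* Matrix (Fin N) (Fin N) ℂ} {I : Set ℝ} {C_b κ m_c : ℝ}
    (h : T_IR mk B r ρ I C_b κ m_c) : T_IRInMean mk B r ρ I C_b κ := by
  obtain ⟨W, hX, hFD, _⟩ := h
  exact ⟨W, hX, fluctuationDecouplingInMean_of hFD⟩

/-- `IRConjecture3 ⟹ IRConjecture3InMean`. [folklore] -/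
theorem irConjecture3InMean_of_irConjecture3 {B : BallSpec G N} {r : G → G → ℝ}
    {ρ : G →* Matrix (Fin N) (Fin N) ℂ} {I : Set ℝ} {C_b κ : ℝ}
    (h : IRConjecture3 B r ρ I C_b κ) : IRConjecture3InMean B r ρ I C_b κ := by
  obtain ⟨W, hE, hFD⟩ := h
  exact ⟨W, hE, fluctuationDecouplingInMean_of hFD⟩

/-- `IRConjecture3InMean ⟹ T_IRInMean` for any construction `mk` (bookkeeping). -/
theorem t_IRInMean_of_conjecture {L : ℕ} (mk : Balaban1985CMP102.Theorems.Construction L) {B : BallSpec G N}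
    {r : G → G → ℝ} {ρ : G →* Matrix (Fin N) (Fin N) ℂ} {I : Set ℝ} {C_b κ : ℝ}
    (h : IRConjecture3InMean B r ρ I C_b κ) : T_IRInMean mk B r ρ I C_b κ := by
  obtain ⟨W, hE, hFD⟩ := h
  exact ⟨W, fun _ => hE, hFD⟩

/-! ## §3 The decay transfer and the composition in the in-mean currency (PROVED bookkeeping) -/

/-- **Decay transfer from the in-mean clauses:** volume-uniform clustering of the coarse laws at rate `m_c` and
`FluctuationDecouplingInMeanAt r ρ W β κ` give `FineUniformClustering r ρ β W (min m_c κ / (3 b(β)))` (link weight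
bounded above, nonnegative rates, probability-or-zero fine laws). [folklore] -/
theorem fineUniformClustering_of_inMean {ρ : G →* Matrix (Fin N) (Fin N) ℂ} {r : G → G → ℝ} {W : BlockFamily G}
    {β m_c κ : ℝ}
    (hP : ∀ (M : ℕ) [NeZero M], IsProbabilityMeasure (fineLaw ρ β W M) ∨ fineLaw ρ β W M = 0)
    (hκ : 0 ≤ κ) (hmc : 0 ≤ m_c) (hr : ∃ D : ℝ, ∀ a b : G, r a b ≤ D)
    (hcoarse : UniformClustering r (coarseFamily ρ β W) m_c) (hfl : FluctuationDecouplingInMeanAt r ρ W β κ) :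
    FineUniformClustering r ρ β W (min m_c κ / (3 * W.factor β)) := by
  obtain ⟨D, hD⟩ := hr
  obtain ⟨A_c, hA⟩ := hcoarse
  obtain ⟨c, hc⟩ := hfl
  exact ⟨_, fun M _ hM =>
    DecayTransferInMean.clustersWith_fine_of_inMean (hP M) hκ hmc hD (hA M hM) (hc M).1 (hc M).2⟩

/-- **The composition with explicit constants, in-mean currency:** `EntersClusterDomain ∧ ClusterDomainClustering ∧
FluctuationDecouplingInMean ⟹ LatticeMassGap3Cofinal I r ρ (min m_c κ / (3 C_b)) C_b` (`0 ≤ min m_c κ`, `r` bounded above;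
every `ρ`). [folklore] -/
theorem latticeMassGap3Cofinal_of_inMean {B : BallSpec G N} {r : G → G → ℝ} {ρ : G →* Matrix (Fin N) (Fin N) ℂ}
    {I : Set ℝ} {W : BlockFamily G} {C_b κ m_c : ℝ} (hm : 0 ≤ min m_c κ)
    (hr : ∃ D : ℝ, ∀ a b : G, r a b ≤ D) (hRB : ClusterDomainClustering B r m_c)
    (hE : EntersClusterDomain B ρ W I C_b) (hFD : FluctuationDecouplingInMean r ρ W I κ) :
    LatticeMassGap3Cofinal I r ρ (min m_c κ / (3 * C_b)) C_b := by
  refine latticeMassGap3Cofinal_of_fine (fun β hβ => (hE β hβ).1) (fun β hβ => ?_)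
  obtain ⟨hb, hmem⟩ := hE β hβ
  have hcoarse : UniformClustering r (coarseFamily ρ β W) m_c :=
    uniformClustering_coarse_of_mem hRB (fun M _ hM => hmem M hM)
  have hfine : FineUniformClustering r ρ β W (min m_c κ / (3 * W.factor β)) :=
    fineUniformClustering_of_inMean
      (fun M _ => DecayTransferProof.isProbabilityMeasure_or_eq_zero_wilsonMeasure (d := 3) (L := W.factor β * M) ρ β)
      (le_min_iff.1 hm).2 (le_min_iff.1 hm).1 hr hcoarse (hFD β hβ)
  refine hfine.mono ?_
  have hbpos : (0 : ℝ) < W.factor β := by exact_mod_cast W.factor_pos β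
  rw [div_div]
  exact div_le_div_of_nonneg_left hm (by positivity) (by nlinarith)

/-- **`massGap3Cofinal_of_inMean`: `BalabanUV3 ∧ ClusterDomainClustering ∧ T_IRInMean ⟹ MassGap3Cofinal I`** — the
statement of record with its conjectural hypothesis WEAKENED to the in-mean form (positive rates and `C_b`, unbounded
`I`, link weight bounded above; every `ρ`).  Bookkeeping; NOT a proof of a mass gap. [folklore] -/
theorem massGap3Cofinal_of_inMean {L : ℕ} {mk : Balaban1985CMP102.Theorems.Construction L} {B : BallSpec G N}
    {r : G → G → ℝ} {ρ : G →* Matrix (Fin N) (Fin N) ℂ} {I : Set ℝ} {C_b κ m_c : ℝ}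
    (hI : ¬ BddAbove I) (hC : 0 < C_b) (hκ : 0 < κ) (hm : 0 < m_c) (hr : ∃ D : ℝ, ∀ a b : G, r a b ≤ D)
    (hUV : BalabanUV3 mk) (hRB : ClusterDomainClustering B r m_c) (hIR : T_IRInMean mk B r ρ I C_b κ) :
    MassGap3Cofinal I r ρ := by
  obtain ⟨W, hX, hFD⟩ := hIR
  exact ⟨hI, min m_c κ / (3 * C_b), div_pos (lt_min hm hκ) (by positivity), C_b,
    latticeMassGap3Cofinal_of_inMean (le_min hm.le hκ.le) hr hRB (hX hUV) hFD⟩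

/-- **`IRConjecture3InMean` version: `BalabanUV3 ∧ ClusterDomainClustering ∧ IRConjecture3InMean ⟹ MassGap3Cofinal I`**
— print ∧ Y2 ∧ ONE conjecture in its weakest used form. [folklore] -/
theorem massGap3Cofinal_of_irConjecture3InMean {L : ℕ} {mk : Balaban1985CMP102.Theorems.Construction L}
    {B : BallSpec G N} {r : G → G → ℝ} {ρ : G →* Matrix (Fin N) (Fin N) ℂ} {I : Set ℝ} {C_b κ m_c : ℝ}
    (hI : ¬ BddAbove I) (hC : 0 < C_b) (hκ : 0 < κ) (hm : 0 < m_c)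
    (hr : ∃ D : ℝ, ∀ a b : G, r a b ≤ D) (hUV : BalabanUV3 mk) (hRB : ClusterDomainClustering B r m_c)
    (hIR : IRConjecture3InMean B r ρ I C_b κ) : MassGap3Cofinal I r ρ :=
  massGap3Cofinal_of_inMean hI hC hκ hm hr hUV hRB (t_IRInMean_of_conjecture mk hIR)

/-- Consistency: the statement of record (`massGap3Cofinal_of`, hypothesis `T_IR`) is recovered THROUGH the in-mean
composition — the in-mean hypothesis is genuinely the weaker one. [folklore] -/
theorem massGap3Cofinal_of_t_IR_via_inMean {L : ℕ} {mk : Balaban1985CMP102.Theorems.Construction L}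
    {B : BallSpec G N} {r : G → G → ℝ} {ρ : G →* Matrix (Fin N) (Fin N) ℂ} {I : Set ℝ} {C_b κ m_c : ℝ}
    (hI : ¬ BddAbove I) (hC : 0 < C_b) (hκ : 0 < κ) (hm : 0 < m_c)
    (hr : ∃ D : ℝ, ∀ a b : G, r a b ≤ D) (hUV : BalabanUV3 mk) (hRB : ClusterDomainClustering B r m_c)
    (hIR : T_IR mk B r ρ I C_b κ m_c) : MassGap3Cofinal I r ρ :=
  massGap3Cofinal_of_inMean hI hC hκ hm hr hUV hRB (t_IRInMean_of_t_IR hIR)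

end Predicates

/-! ## §4 Instances: Y2's `SU(N)` ball; Bałaban's coupling set -/

section SUN

open Literature.MathematicalPhysics.QuantumLattice

/-- **Y2's tier-2 ball, a.s. currency (one-liner on ds-1's `massGap3Cofinal_of_irConjecture3`):** Y2's clustering on
the ball for every Wilson-part coupling `0 ≤ β' ≤ β⋆` ∧ `BalabanUV3` ∧ `IRConjecture3` for the instantiated ball in
the metric `suFrobDist` ⟹ `MassGap3Cofinal I suFrobDist (fundamental)`. [folklore] -/
theorem massGap3Cofinal_SUN_of_irConjecture3 {N : ℕ} {κ ε₀ ε₁ βstar A m_c : ℝ} {L : ℕ}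
    {mk : Balaban1985CMP102.Theorems.Construction L} {I : Set ℝ} {C_b κf : ℝ}
    (hY2 : ∀ β' : ℝ, 0 ≤ β' → β' ≤ βstar → RobustBall.TorusClusteringOnBallW N 3 β' κ ε₀ ε₁ A m_c)
    (hI : ¬ BddAbove I) (hC : 0 < C_b) (hκ : 0 < κf) (hm : 0 < m_c) (hUV : BalabanUV3 mk)
    (hIR : IRConjecture3 (ballOfRobustBall N κ ε₀ ε₁ βstar) suFrobDist (fundamentalRep (Fin N)) I C_b κf) :
    MassGap3Cofinal I suFrobDist (fundamentalRep (Fin N)) :=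
  DecayTransferProof.massGap3Cofinal_of_irConjecture3' hI hC hκ hm (suFrobDist_bddAbove N) hUV
    (clusterDomainClustering_of_torusClusteringOnBallW hY2) hIR

/-- **Y2's tier-2 ball, in-mean currency:** the same with `IRConjecture3InMean`. [folklore] -/
theorem massGap3Cofinal_SUN_of_irConjecture3InMean {N : ℕ} {κ ε₀ ε₁ βstar A m_c : ℝ} {L : ℕ}
    {mk : Balaban1985CMP102.Theorems.Construction L} {I : Set ℝ} {C_b κf : ℝ}
    (hY2 : ∀ β' : ℝ, 0 ≤ β' → β' ≤ βstar → RobustBall.TorusClusteringOnBallW N 3 β' κ ε₀ ε₁ A m_c)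
    (hI : ¬ BddAbove I) (hC : 0 < C_b) (hκ : 0 < κf) (hm : 0 < m_c) (hUV : BalabanUV3 mk)
    (hIR : IRConjecture3InMean (ballOfRobustBall N κ ε₀ ε₁ βstar) suFrobDist (fundamentalRep (Fin N)) I C_b κf) :
    MassGap3Cofinal I suFrobDist (fundamentalRep (Fin N)) :=
  massGap3Cofinal_of_irConjecture3InMean hI hC hκ hm (suFrobDist_bddAbove N) hUV
    (clusterDomainClustering_of_torusClusteringOnBallW hY2) hIR

/-- **Y2's tier-1 ball (rb-theory's receiving currency `TorusClusteringOnBallUpTo`, BY NAME), in-mean currency.**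
[folklore] -/
theorem massGap3Cofinal_SUN_upTo_of_irConjecture3InMean {N : ℕ} {ε₀ ε₁ βstar A m_c : ℝ} {rFR L : ℕ}
    {mk : Balaban1985CMP102.Theorems.Construction L} {I : Set ℝ} {C_b κf : ℝ}
    (hY2 : RobustBall.TorusClusteringOnBallUpTo N 3 βstar ε₀ ε₁ rFR A m_c)
    (hI : ¬ BddAbove I) (hC : 0 < C_b) (hκ : 0 < κf) (hm : 0 < m_c) (hUV : BalabanUV3 mk)
    (hIR : IRConjecture3InMean (ballOfRobustBallFR N ε₀ ε₁ rFR βstar) suFrobDist (fundamentalRep (Fin N)) I C_b κf) :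
    MassGap3Cofinal I suFrobDist (fundamentalRep (Fin N)) :=
  massGap3Cofinal_of_irConjecture3InMean hI hC hκ hm (suFrobDist_bddAbove N) hUV
    (clusterDomainClustering_of_torusClusteringOnBallUpTo hY2) hIR

end SUN

section Balaban

open CarrierBridge Balaban1985CMP102 Balaban1985CMP102.Setting Balaban1985CMP102.Theorems
open Literature.MathematicalPhysics.QuantumFieldTheory.Balaban1983to89 (GaugeGroup)

variable {L : ℕ} {G : Type} [GaugeGroup G] [MeasurableSpace G] [TopologicalSpace G] [IsTopologicalGroup G]
  [CompactSpace G] [BorelSpace G]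

/-- **Bałaban's coupling set, in-mean currency (one-liner; cf. theory-1's `massGap3Cofinal_balaban_of_irConjecture3`):**
for an inhabited family (any printed representation `𝔊.ρ`), `BalabanUV3 mk → ClusterDomainClustering B r m_c →
IRConjecture3InMean B r 𝔊.ρ (balabanCouplings L 𝔊 eps0) C_b κ → MassGap3Cofinal (balabanCouplings L 𝔊 eps0) r 𝔊.ρ`
(`¬ BddAbove` by `not_bddAbove_balabanCouplings`). [cite: Balaban1985UV3, Thm 1 p.257; Thm 2 p.272] -/
theorem massGap3Cofinal_balaban_of_irConjecture3InMean {mk : Construction L} (𝔊 : GroupModel G)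
    {eps0 : ℝ → ℝ} (hfam : Nonempty (Family L eps0)) {B : BallSpec G 𝔊.N}
    {r : G → G → ℝ} {C_b κ m_c : ℝ} (hC : 0 < C_b) (hκ : 0 < κ) (hm : 0 < m_c)
    (hr : ∃ D : ℝ, ∀ a b : G, r a b ≤ D) (hUV : BalabanUV3 mk) (hRB : ClusterDomainClustering B r m_c)
    (hIR : IRConjecture3InMean B r 𝔊.ρ (balabanCouplings L 𝔊 eps0) C_b κ) :
    MassGap3Cofinal (balabanCouplings L 𝔊 eps0) r 𝔊.ρ :=
  massGap3Cofinal_of_irConjecture3InMean (not_bddAbove_balabanCouplings 𝔊 hfam) hC hκ hm hr hUV hRB hIR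

end Balaban

end Summit.Ventures.YMGap.YM3IR

end
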